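import Summits.HodgeConjecture.HodgeConjecture.Theorems.F0P3cStCharTSHSt               -- ★ `steinbergLabel_smoothTrace_eq` (`Tr πSt = Tr i_H(χ_H) − χ_{ξ_v}` on test functions)
import Summits.HodgeConjecture.HodgeConjecture.Theorems.F0P3cStCharTSEllOpen            -- ★ S8a `isOpen_setOf_isRegularElt_and_not_mem_hyperbolicSet` (+ ★ HYP-EIG `mem_hyperbolicSet_of_isRoot`, ★ TorusDefs `hyperbolicSet`)
import Literature.NumberTheory.Automorphic.CMPrincipalSeriesHTraceOrbitalForm            -- ★ brings S2 `exists_smoothTrace_cmPrincipalSeriesH_eq_integral_torus` (van Dijk, torus form, on `H_v`), ★ `isAdmissible_cmPrincipalSeriesH`, ★ `smoothTrace_eq_haarScalarFactor_mul_smoothTrace`, ★ `exists_borel_mul_mem_cmLocalIntegralLevel`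
import Literature.NumberTheory.Rogawski1990.EndoscopicEmbedding                          -- ★ `endoEmbLocal`, `coe_endoEmbLocal`, `coe_endoGL_eq`, `continuous_endoEmbLocal`
import Literature.NumberTheory.Rogawski1990.UnitFundamentalLemmaInertLeviClause          -- ★ `isLocalGRegular_conj_iff`
import Summits.HodgeConjecture.HodgeConjecture.Theorems.F0P3XiLocalCharOpenKernel      -- ★ `isOpen_ker_xiLocalChar`
import Summits.HodgeConjecture.HodgeConjecture.Theorems.F0P3bHPrincipalSeriesJHOfUTwo   -- ★ `isOpen_ker_of_continuous_unitsComplex`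
import Summits.HodgeConjecture.HodgeConjecture.Theorems.F0P3cStCharTSCasselmanCap       -- ★ `integral_indicator_mul_eq_of_eqOn`
import Summits.HodgeConjecture.HodgeConjecture.Theorems.F0P3cStCharTSClassFn            -- ★ `totallyDisconnectedSpace_cmDatum_local`
import Literature.NumberTheory.Automorphic.CMLocalRingModulusContinuous                  -- ★ `continuous_quotConj`, `continuous_halfModulusChar_apply`
import Literature.NumberTheory.Automorphic.TorusCharacterLocalComponents                 -- ★ `continuous_torusLocalComponent`
import Literature.NumberTheory.Automorphic.CMPrincipalSeriesJacquetEvalOne               -- ★ `continuous_torusCharPair_apply`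
import Literature.Topology.LocallyConstantExtend                                         -- ★ `exists_isCompact_isOpen_mem_subset`
import HarnessLib

/-!
# F0 · P3c · line LH6 «StCharTS» — road «ST-STABLE-H», brick (B1) «ELL-VALUE-H★»: the character of the `H`-side Steinberg label takes the value
# `−ξ_v` at every `G`-regular point of `H_v = U(Φ₂)(L⁺_v) × U(Φ₁)(L⁺_v)` whose image under the endoscopic embedding lies OFF the regular hyperbolic set `Ω`

Cell `pub/hodgecm-mathlib`, crux H413 = `stmt-HodgeConjecture-24833` (lane `--supports … --as helper`), route HCCMUnconditional; seat F0P3-p04 (g18),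
NAMING «ST-STABLE-H★» 2026-09-02T13:58Z (LEAD F0P3a-plan (g14) T13-40 «=»).  THEOREMS ONLY, sorry-free, ★-only imports; no definition ∕ instance ∕ notation ∕
named fact.  HONEST LABEL: HC_CM is proved only modulo the 7 printed citations (2 remaining: hLiu418 = stmt-HodgeConjecture-24832, h413 =
stmt-HodgeConjecture-24833) until rung 0 closes; this file is count-neutral (first brick of the in-house payment of the RUNG0 antecedent `hstab`
«`χ_{St_H(ξ_v)}` is a STABLE class function on the `G`-regular set», [Rogawski1990, §12.5 p. 183; §11.1]).

THE MATHEMATICS ([Rogawski1990, §12.1 case (1) pp. 171–172; §4.9 Lemma 4.9.2 ∕ (4.9.4) p. 56 for `H`; §12.5 pp. 182–184]; [vanDijk1972]).  Let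
`ι = endoEmbLocal L v : H_v →* U(Φ₃)(L⁺_v)` and `V_H := {a ∈ H_v | a is G-regular ∧ ι a ∉ Ω}` (`Ω = hyperbolicSet L v`, the conjugates of the regular elements of the
split torus of `U(Φ₃)`).  Let `Θ : H_v → ℂ` be locally constant at the `G`-regular points and compute `Tr πSt` on test functions, where `(π₁, πSt)` are the
`HLengthTwoLabels` of `i_H(χ_H)` with `Tr π₁ = χ_{ξ_v}` (the organ's binders).  Then **`Θ a = −ξ_v(a)` for every `a ∈ V_H`.**  Proof: `V_H` is OPEN (§3: the preimage
of ★ S8a's open set `G^r ∖ Ω` under the continuous `ι`), `H_v` is totally disconnected, and `ξ_v` has open kernel, so some compact-open `U ∋ a` inside `V_H` has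
`Θ|_U ≡ Θ a`, `ξ_v|_U ≡ ξ_v a`; with `f_H = 𝟙_U`: `Tr πSt(𝟙_U) = ν(U)·Θ a` and, by ★ HSt, `Tr πSt(𝟙_U) = Tr i_H(χ_H)(𝟙_U) − χ_{ξ_v}(𝟙_U) = 0 − ν(U)·ξ_v(a)` —
the principal-series trace VANISHES (§2, van Dijk's support statement on `H_v`): in the torus form ★ S2 the integrand is `f_H(k (t n) k⁻¹, u)` (`t ∈ T₂`, `n ∈ N₂`,
`k ∈ K₂`), and a `G`-regular `(t n, u)` has `ι(t n, u)` upper triangular in `U(Φ₃)` with corner eigenvalue `d₀`, `d₀ σ(d₀) ≠ 1` (else the `Φ₂`-relation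
`σ(d₀) d₁ = 1` forces the double root `d₀ = d₁`), so `ι(t n, u) ∈ Ω` by ★ HYP-EIG (§1) and `(k (t n) k⁻¹, u) ∉ V_H`; as `ν(U) > 0`, `Θ a = −ξ_v(a)`.
* §1 `endoEmbLocal_torus_mul_unipotent_mem_hyperbolicSet`, `not_VH_conj_torus_mul_unipotent` — the support algebra;
* §2 `smoothTrace_cmPrincipalSeriesH_eq_zero_of_support` — «VAN-DIJK-VANISH-H»: `Tr i_H(χ₂ ⊠ χ₁)(f_H; ν_H) = 0` for `f_H` supported in `V_H` (any Haar `ν_H`);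
* §3 `isOpen_VH` — `V_H` is open;
* §4 `charSt_eq_neg_xiLocalChar_of_not_mem_hyperbolicSet` — «ELL-VALUE-H».

## References
* [Rogawski1990] J. D. Rogawski, *Automorphic Representations of Unitary Groups in Three Variables* (1990): §12.1 pp. 171–172; §4.9 (4.9.4) p. 56; §12.5 pp. 182–184; §11.1.
* [vanDijk1972] G. van Dijk, *Computation of certain induced characters of 𝔭-adic groups*, Math. Ann. 199 (1972), Thm. p. 237.
-/

set_option autoImplicit false
-- the mandated namespace has the single-problem summit's repeated segment (`HodgeConjecture.HodgeConjecture`)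
set_option linter.dupNamespace false

noncomputable section

open NumberField IsDedekindDomain MeasureTheory Filter Topology Set Polynomial
open scoped Matrix MatrixGroups
open Literature.NumberTheory Literature.NumberTheory.Automorphic Literature.NumberTheory.Automorphic.UnitaryGroup
open Literature.NumberTheory.GaloisRepresentations
open Literature.NumberTheory.Rogawski1990
open Summit.HodgeConjecture.HodgeConjecture.Cruxes.H413.F0P3cStCharTSTorusDefs

namespace Summit.HodgeConjecture.HodgeConjecture.Cruxes.H413.F0P3cStCharTSStStableEll

variable (L : Type) [Field L] [NumberField L] [IsCMField L] (v : HeightOneSpectrum (𝓞 ↥(maximalRealSubfield L)))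

/-! ## §1 Support algebra: a `G`-regular image of `T₂ N₂ × U₁` lies in `Ω` -/

/-- Pure polynomial algebra: `(X − a)·q·(X − a)` is never separable over a nontrivial commutative ring. [folklore] -/
theorem not_separable_X_sub_C_mul_mul_X_sub_C {R : Type*} [CommRing R] [Nontrivial R] (a : R) (q : R[X]) :
    ¬ ((X - C a) * (q * (X - C a))).Separable := by
  intro h
  have hc : IsCoprime (X - C a) (X - C a) := (Polynomial.Separable.isCoprime h).of_mul_right_right
  exact Polynomial.not_isUnit_X_sub_C a (isCoprime_self.1 hc)

set_option maxHeartbeats 1600000 in  -- statement-level `whnf` on the CM carriers (as in ★ HYP-EIG ∕ ★ S8a)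
set_option synthInstance.maxHeartbeats 400000 in
/-- **A `G`-regular `(t n, u)` (`t ∈ T₂`, `n ∈ N₂`) has `ι(t n, u) ∈ Ω`** (non-split `v`).  The matrix of `ι(t n, u)` is `(d₀ 0 b; 0 u 0; 0 0 d₁)` (★ `coe_endoGL_eq`),
upper triangular, so its characteristic polynomial is `(X − d₀)(X − u)(X − d₁)` (Mathlib `Matrix.charpoly_of_upperTriangular`): `d₀` is a root, and
`d₀ σ(d₀) ≠ 1` — otherwise the `Φ₂`-relation `σ(d₀) d₁ = 1` (★ `glDiagonal_mem_unitaryGroupOfForm_antidiagonal_iff`) gives `d₁ = d₀`, a double root, contradicting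
`G`-regularity (separability); conclude by ★ HYP-EIG `mem_hyperbolicSet_of_isRoot`. [cite: Rogawski1990, §12.5 p. 182; §4.9 (4.9.4) p. 56; §1.10 p. 9] -/
theorem endoEmbLocal_torus_mul_unipotent_mem_hyperbolicSet (hns : ∀ w : PlacesOver L v, IsCMField.complexConj L • w.1 = w.1)
    (t : ↥(cmBorelTriple L 2 v).M) (n : ↥(cmBorelTriple L 2 v).N)
    (u : (cmDatum L 1 (Matrix.of fun i j : Fin 1 => if i.val + j.val + 1 = 1 then (1 : L) else 0)).Local v)
    (hreg : IsLocalGRegular L v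
      (((t : ↥(unitaryGroupOfForm (conjLocal L (IsCMField.complexConj L) v) (cmLocalForm L 2 v))) *
          (n : ↥(unitaryGroupOfForm (conjLocal L (IsCMField.complexConj L) v) (cmLocalForm L 2 v))) :
          (cmDatum L 2 (Matrix.of fun i j : Fin 2 => if i.val + j.val + 1 = 2 then (1 : L) else 0)).Local v), u)) :
    endoEmbLocal L v
        (((t : ↥(unitaryGroupOfForm (conjLocal L (IsCMField.complexConj L) v) (cmLocalForm L 2 v))) *
            (n : ↥(unitaryGroupOfForm (conjLocal L (IsCMField.complexConj L) v) (cmLocalForm L 2 v))) :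
            (cmDatum L 2 (Matrix.of fun i j : Fin 2 => if i.val + j.val + 1 = 2 then (1 : L) else 0)).Local v), u) ∈
      hyperbolicSet L v := by
  -- abbreviations
  set σ := conjLocal L (IsCMField.complexConj L) v with hσ
  set g : (cmDatum L 2 (Matrix.of fun i j : Fin 2 => if i.val + j.val + 1 = 2 then (1 : L) else 0)).Local v :=
    ((t : ↥(unitaryGroupOfForm (conjLocal L (IsCMField.complexConj L) v) (cmLocalForm L 2 v))) *
      (n : ↥(unitaryGroupOfForm (conjLocal L (IsCMField.complexConj L) v) (cmLocalForm L 2 v)))) with hg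
  -- `t = diag(d)`, `n` upper unitriangular
  obtain ⟨d, hd⟩ := (mem_torusU_iff
    (t : ↥(unitaryGroupOfForm (conjLocal L (IsCMField.complexConj L) v) (cmLocalForm L 2 v)))).1 t.2
  have hnU := (mem_unipotentU_iff
    (n : ↥(unitaryGroupOfForm (conjLocal L (IsCMField.complexConj L) v) (cmLocalForm L 2 v)))).1 n.2
  -- the `Φ₂` torus relation `σ(d₀) d₁ = 1`
  have hrel : σ (d 0 : LocalRing L v) * (d 1 : LocalRing L v) = 1 := by
    have hmem : glDiagonal 2 (LocalRing L v) d ∈ unitaryGroupOfForm σ ((StdForm.antidiagonal 2).over (LocalRing L v)) := by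
      rw [← cmLocalForm_eq_over L 2 v, hd]; exact t.1.2
    have := (glDiagonal_mem_unitaryGroupOfForm_antidiagonal_iff σ 2 d).1 hmem 1
    simpa using this
  -- entries of `g = t n`: `g i j = d i * n i j`
  have hgmat : ((g.val : GL (Fin 2) (LocalRing L v)) : Matrix (Fin 2) (Fin 2) (LocalRing L v)) =
      Matrix.diagonal (fun i => (d i : LocalRing L v)) *
        (((n : ↥(unitaryGroupOfForm (conjLocal L (IsCMField.complexConj L) v) (cmLocalForm L 2 v))) : GL (Fin 2) (LocalRing L v)) :
          Matrix (Fin 2) (Fin 2) (LocalRing L v)) := by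
    rw [hg]
    show ((((t : ↥(unitaryGroupOfForm (conjLocal L (IsCMField.complexConj L) v) (cmLocalForm L 2 v))) : GL (Fin 2) (LocalRing L v)) *
      ((n : ↥(unitaryGroupOfForm (conjLocal L (IsCMField.complexConj L) v) (cmLocalForm L 2 v))) : GL (Fin 2) (LocalRing L v)) : GL (Fin 2) (LocalRing L v)) :
        Matrix (Fin 2) (Fin 2) (LocalRing L v)) = _
    rw [Units.val_mul, ← hd, coe_glDiagonal]
  have hn10 : (((n : ↥(unitaryGroupOfForm (conjLocal L (IsCMField.complexConj L) v) (cmLocalForm L 2 v))) : GL (Fin 2) (LocalRing L v)) :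
      Matrix (Fin 2) (Fin 2) (LocalRing L v)) 1 0 = 0 := hnU.1 (by decide)
  have hn00 := hnU.2 0
  have hn11 := hnU.2 1
  have hg00 : ((g.val : GL (Fin 2) (LocalRing L v)) : Matrix (Fin 2) (Fin 2) (LocalRing L v)) 0 0 = d 0 := by
    rw [hgmat, Matrix.diagonal_mul, hn00, mul_one]
  have hg11 : ((g.val : GL (Fin 2) (LocalRing L v)) : Matrix (Fin 2) (Fin 2) (LocalRing L v)) 1 1 = d 1 := by
    rw [hgmat, Matrix.diagonal_mul, hn11, mul_one]
  have hg10 : ((g.val : GL (Fin 2) (LocalRing L v)) : Matrix (Fin 2) (Fin 2) (LocalRing L v)) 1 0 = 0 := by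
    rw [hgmat, Matrix.diagonal_mul, hn10, mul_zero]
  -- the matrix of `ι(g, u)`
  set M : Matrix (Fin 3) (Fin 3) (LocalRing L v) :=
    (((endoEmbLocal L v (g, u)).val : GL (Fin 3) (LocalRing L v)) : Matrix (Fin 3) (Fin 3) (LocalRing L v)) with hM
  have hMeq : M = !![((g.val : GL (Fin 2) (LocalRing L v)) : Matrix (Fin 2) (Fin 2) (LocalRing L v)) 0 0, 0,
        ((g.val : GL (Fin 2) (LocalRing L v)) : Matrix (Fin 2) (Fin 2) (LocalRing L v)) 0 1;
      0, ((u.val : GL (Fin 1) (LocalRing L v)) : Matrix (Fin 1) (Fin 1) (LocalRing L v)) 0 0, 0;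
      ((g.val : GL (Fin 2) (LocalRing L v)) : Matrix (Fin 2) (Fin 2) (LocalRing L v)) 1 0, 0,
        ((g.val : GL (Fin 2) (LocalRing L v)) : Matrix (Fin 2) (Fin 2) (LocalRing L v)) 1 1] := by
    rw [hM, coe_endoEmbLocal, coe_endoGL_eq]
  have hM00 : M 0 0 = d 0 := by rw [hMeq, ← hg00]; rfl
  have hM11 : M 1 1 = ((u.val : GL (Fin 1) (LocalRing L v)) : Matrix (Fin 1) (Fin 1) (LocalRing L v)) 0 0 := by rw [hMeq]; rfl
  have hM22 : M 2 2 = d 1 := by rw [hMeq, ← hg11]; rfl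
  have htri : M.BlockTriangular id := by
    intro i j hij
    simp only [id] at hij
    rw [hMeq]
    fin_cases i <;> fin_cases j <;> first | exact absurd hij (by decide) | rfl | exact hg10
  have hchar : M.charpoly = (X - C (d 0 : LocalRing L v)) *
      ((X - C (((u.val : GL (Fin 1) (LocalRing L v)) : Matrix (Fin 1) (Fin 1) (LocalRing L v)) 0 0)) * (X - C (d 1 : LocalRing L v))) := by
    rw [Matrix.charpoly_of_upperTriangular M htri, Fin.prod_univ_three, hM00, hM11, hM22, mul_assoc]
  -- `G`-regularity = separability of `charpoly M`
  have hsep : M.charpoly.Separable := hreg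
  -- (a) `d₀` is a root
  have hroot : M.charpoly.IsRoot (d 0 : LocalRing L v) := by
    rw [hchar, Polynomial.IsRoot, eval_mul, eval_sub, eval_X, eval_C, sub_self, zero_mul]
  -- (b) `d₀ σ(d₀) ≠ 1`
  have hne : (d 0 : LocalRing L v) * σ (d 0 : LocalRing L v) ≠ 1 := by
    intro h1
    -- `σ(d₀) d₁ = 1 = σ(d₀) d₀` ⇒ `d₁ = d₀`
    have hσu : IsUnit (σ (d 0 : LocalRing L v)) := IsUnit.of_mul_eq_one_right (d 0 : LocalRing L v) h1
    have hd10 : (d 1 : LocalRing L v) = d 0 := by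
      have h2 : σ (d 0 : LocalRing L v) * (d 1 : LocalRing L v) = σ (d 0 : LocalRing L v) * (d 0 : LocalRing L v) := by
        rw [hrel, mul_comm, h1]
      exact hσu.mul_left_cancel h2
    rw [hchar, hd10] at hsep
    exact not_separable_X_sub_C_mul_mul_X_sub_C _ _ hsep
  exact F0P3cStCharTSHyperbolicSetEigen.mem_hyperbolicSet_of_isRoot L v hns hreg hroot hne

/-! ## §2 «VAN-DIJK-VANISH-H»: the character of `i_H(χ₂ ⊠ χ₁)` kills test functions supported in `V_H` -/

/-- Conjugation invariance of `Ω`. [cite: Rogawski1990, §12.5 p. 182] -/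
theorem conj_mem_hyperbolicSet {γ : Gqs L v} (hγ : γ ∈ hyperbolicSet L v) (x : Gqs L v) : x * γ * x⁻¹ ∈ hyperbolicSet L v := by
  obtain ⟨t, ht, hc⟩ := hγ
  exact ⟨t, ht, hc.trans (isConj_iff.2 ⟨x, rfl⟩)⟩

set_option maxHeartbeats 1600000 in
set_option synthInstance.maxHeartbeats 400000 in
/-- **«VAN-DIJK-VANISH-H»: `Tr i_H(χ₂ ⊠ χ₁)(f_H; ν_H) = 0` for every test function `f_H` supported in `V_H = {G-regular} ∖ ι⁻¹(Ω)`** (any Haar measure `ν_H`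
on `H_v`, ANY Borel structure; non-split `v`; `χ₂` continuous, `χ₁` with open kernel).  By van Dijk's formula in torus form (★ S2
`exists_smoothTrace_cmPrincipalSeriesH_eq_integral_torus`, moved to `ν_H` by ★ `Representation.smoothTrace_eq_haarScalarFactor_mul_smoothTrace`) the trace is an iterated integral
of `f_H (k (t n) k⁻¹, u)` over `k ∈ K₂`, `t ∈ T₂`, `n ∈ N₂`, `u ∈ U(Φ₁)_v`, and this integrand vanishes IDENTICALLY: if `f_H ≠ 0` there, the point is `G`-regular with image off `Ω`,
but it is `H_v`-conjugate to `(t n, u)`, whose image lies IN `Ω` (§1) — and `Ω`, `G`-regularity are conjugation-stable.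
[cite: Rogawski1990, §4.9 Lemma 4.9.2, (4.9.4) p. 56; §12.1 p. 171; §12.5 p. 182] [cite: vanDijk1972, Thm. p. 237] -/
theorem smoothTrace_cmPrincipalSeriesH_eq_zero_of_support (hns : ∀ w : PlacesOver L v, IsCMField.complexConj L • w.1 = w.1)
    [mHH : MeasurableSpace (((cmDatum L 2 (Matrix.of fun i j : Fin 2 => if i.val + j.val + 1 = 2 then (1 : L) else 0)).Local v) × ((cmDatum L 1 (Matrix.of fun i j : Fin 1 => if i.val + j.val + 1 = 1 then (1 : L) else 0)).Local v))] [BorelSpace (((cmDatum L 2 (Matrix.of fun i j : Fin 2 => if i.val + j.val + 1 = 2 then (1 : L) else 0)).Local v) × ((cmDatum L 1 (Matrix.of fun i j : Fin 1 => if i.val + j.val + 1 = 1 then (1 : L) else 0)).Local v))]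
    (νH : Measure (((cmDatum L 2 (Matrix.of fun i j : Fin 2 => if i.val + j.val + 1 = 2 then (1 : L) else 0)).Local v) × ((cmDatum L 1 (Matrix.of fun i j : Fin 1 => if i.val + j.val + 1 = 1 then (1 : L) else 0)).Local v))) [νH.IsHaarMeasure]
    (χ₂ : ↥(torusU (conjLocal L (IsCMField.complexConj L) v) (cmLocalForm L 2 v)) →* ℂˣ) (hχ₂ : Continuous fun t => ((χ₂ t : ℂˣ) : ℂ))
    (χ₁ : ((cmDatum L 1 (Matrix.of fun i j : Fin 1 => if i.val + j.val + 1 = 1 then (1 : L) else 0)).Local v) →* ℂˣ) (hχ₁ : IsOpen ((χ₁.ker : Subgroup ((cmDatum L 1 (Matrix.of fun i j : Fin 1 => if i.val + j.val + 1 = 1 then (1 : L) else 0)).Local v)) : Set ((cmDatum L 1 (Matrix.of fun i j : Fin 1 => if i.val + j.val + 1 = 1 then (1 : L) else 0)).Local v)))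
    (fH : (((cmDatum L 2 (Matrix.of fun i j : Fin 2 => if i.val + j.val + 1 = 2 then (1 : L) else 0)).Local v) × ((cmDatum L 1 (Matrix.of fun i j : Fin 1 => if i.val + j.val + 1 = 1 then (1 : L) else 0)).Local v)) → ℂ) (hfH : IsLocallyConstant fH) (hfHc : HasCompactSupport fH)
    (hsupp : ∀ h : (((cmDatum L 2 (Matrix.of fun i j : Fin 2 => if i.val + j.val + 1 = 2 then (1 : L) else 0)).Local v) × ((cmDatum L 1 (Matrix.of fun i j : Fin 1 => if i.val + j.val + 1 = 1 then (1 : L) else 0)).Local v)), fH h ≠ 0 → IsLocalGRegular L v h ∧ endoEmbLocal L v h ∉ hyperbolicSet L v) :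
    haveI := locallyCompactSpace_cmBorelU L 2 v
    (cmPrincipalSeriesH L v χ₂ χ₁).smoothTrace νH fH = 0 := by
  haveI := locallyCompactSpace_cmBorelU L 2 v
  have hc := IsCMField.complexConj_ne_one L
  -- Borel structures on the two factors (both spellings); the given structure on the product IS their product (below)
  letI : MeasurableSpace ((cmDatum L 2 (Matrix.of fun i j : Fin 2 => if i.val + j.val + 1 = 2 then (1 : L) else 0)).Local v) := borel _
  haveI : BorelSpace ((cmDatum L 2 (Matrix.of fun i j : Fin 2 => if i.val + j.val + 1 = 2 then (1 : L) else 0)).Local v) := ⟨rfl⟩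
  letI : MeasurableSpace ↥(unitaryGroupOfForm (conjLocal L (IsCMField.complexConj L) v) (cmLocalForm L 2 v)) := ‹MeasurableSpace ((cmDatum L 2 (Matrix.of fun i j : Fin 2 => if i.val + j.val + 1 = 2 then (1 : L) else 0)).Local v)›
  haveI : BorelSpace ↥(unitaryGroupOfForm (conjLocal L (IsCMField.complexConj L) v) (cmLocalForm L 2 v)) := ‹BorelSpace ((cmDatum L 2 (Matrix.of fun i j : Fin 2 => if i.val + j.val + 1 = 2 then (1 : L) else 0)).Local v)›
  letI : MeasurableSpace ((cmDatum L 1 (Matrix.of fun i j : Fin 1 => if i.val + j.val + 1 = 1 then (1 : L) else 0)).Local v) := borel _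
  haveI : BorelSpace ((cmDatum L 1 (Matrix.of fun i j : Fin 1 => if i.val + j.val + 1 = 1 then (1 : L) else 0)).Local v) := ⟨rfl⟩
  letI : MeasurableSpace ↥(unitaryGroupOfForm (conjLocal L (IsCMField.complexConj L) v) (cmLocalForm L 1 v)) := ‹MeasurableSpace ((cmDatum L 1 (Matrix.of fun i j : Fin 1 => if i.val + j.val + 1 = 1 then (1 : L) else 0)).Local v)›
  haveI : BorelSpace ↥(unitaryGroupOfForm (conjLocal L (IsCMField.complexConj L) v) (cmLocalForm L 1 v)) := ‹BorelSpace ((cmDatum L 1 (Matrix.of fun i j : Fin 1 => if i.val + j.val + 1 = 1 then (1 : L) else 0)).Local v)›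
  haveI : LocallyCompactSpace ↥(unitaryGroupOfForm (conjLocal L (IsCMField.complexConj L) v) (cmLocalForm L 2 v)) := locallyCompactSpace_local (IsCMField.complexConj L) 2 _ v
  haveI : SecondCountableTopology ↥(unitaryGroupOfForm (conjLocal L (IsCMField.complexConj L) v) (cmLocalForm L 2 v)) := secondCountableTopology_local (IsCMField.complexConj L) 2 _ v
  haveI : T2Space ↥(unitaryGroupOfForm (conjLocal L (IsCMField.complexConj L) v) (cmLocalForm L 2 v)) := t2Space_cmDatum_local 2 L (Matrix.of fun i j : Fin 2 => if i.val + j.val + 1 = 2 then (1 : L) else 0) v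
  haveI := nonarchimedeanGroup_cmLocal L 2 v
  haveI : LocallyCompactSpace ↥(unitaryGroupOfForm (conjLocal L (IsCMField.complexConj L) v) (cmLocalForm L 1 v)) := locallyCompactSpace_local (IsCMField.complexConj L) 1 _ v
  haveI : SecondCountableTopology ↥(unitaryGroupOfForm (conjLocal L (IsCMField.complexConj L) v) (cmLocalForm L 1 v)) := secondCountableTopology_local (IsCMField.complexConj L) 1 _ v
  haveI : T2Space ↥(unitaryGroupOfForm (conjLocal L (IsCMField.complexConj L) v) (cmLocalForm L 1 v)) := t2Space_cmDatum_local 1 L (Matrix.of fun i j : Fin 1 => if i.val + j.val + 1 = 1 then (1 : L) else 0) v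
  haveI := nonarchimedeanGroup_cmLocal L 1 v
  haveI : LocallyCompactSpace ((cmDatum L 2 (Matrix.of fun i j : Fin 2 => if i.val + j.val + 1 = 2 then (1 : L) else 0)).Local v) := ‹LocallyCompactSpace ↥(unitaryGroupOfForm (conjLocal L (IsCMField.complexConj L) v) (cmLocalForm L 2 v))›
  haveI : SecondCountableTopology ((cmDatum L 2 (Matrix.of fun i j : Fin 2 => if i.val + j.val + 1 = 2 then (1 : L) else 0)).Local v) := ‹SecondCountableTopology ↥(unitaryGroupOfForm (conjLocal L (IsCMField.complexConj L) v) (cmLocalForm L 2 v))›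
  haveI : T2Space ((cmDatum L 2 (Matrix.of fun i j : Fin 2 => if i.val + j.val + 1 = 2 then (1 : L) else 0)).Local v) := ‹T2Space ↥(unitaryGroupOfForm (conjLocal L (IsCMField.complexConj L) v) (cmLocalForm L 2 v))›
  haveI : NonarchimedeanGroup ((cmDatum L 2 (Matrix.of fun i j : Fin 2 => if i.val + j.val + 1 = 2 then (1 : L) else 0)).Local v) := ‹NonarchimedeanGroup ↥(unitaryGroupOfForm (conjLocal L (IsCMField.complexConj L) v) (cmLocalForm L 2 v))›
  haveI : LocallyCompactSpace ((cmDatum L 1 (Matrix.of fun i j : Fin 1 => if i.val + j.val + 1 = 1 then (1 : L) else 0)).Local v) := ‹LocallyCompactSpace ↥(unitaryGroupOfForm (conjLocal L (IsCMField.complexConj L) v) (cmLocalForm L 1 v))›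
  haveI : SecondCountableTopology ((cmDatum L 1 (Matrix.of fun i j : Fin 1 => if i.val + j.val + 1 = 1 then (1 : L) else 0)).Local v) := ‹SecondCountableTopology ↥(unitaryGroupOfForm (conjLocal L (IsCMField.complexConj L) v) (cmLocalForm L 1 v))›
  haveI : T2Space ((cmDatum L 1 (Matrix.of fun i j : Fin 1 => if i.val + j.val + 1 = 1 then (1 : L) else 0)).Local v) := ‹T2Space ↥(unitaryGroupOfForm (conjLocal L (IsCMField.complexConj L) v) (cmLocalForm L 1 v))›
  haveI : NonarchimedeanGroup ((cmDatum L 1 (Matrix.of fun i j : Fin 1 => if i.val + j.val + 1 = 1 then (1 : L) else 0)).Local v) := ‹NonarchimedeanGroup ↥(unitaryGroupOfForm (conjLocal L (IsCMField.complexConj L) v) (cmLocalForm L 1 v))›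
  haveI : T1Space (LocalRing L v) := inferInstance
  haveI : SigmaCompactSpace ((cmDatum L 2 (Matrix.of fun i j : Fin 2 => if i.val + j.val + 1 = 2 then (1 : L) else 0)).Local v) := sigmaCompactSpace_of_locallyCompact_secondCountable
  haveI : SigmaCompactSpace ((cmDatum L 1 (Matrix.of fun i j : Fin 1 => if i.val + j.val + 1 = 1 then (1 : L) else 0)).Local v) := sigmaCompactSpace_of_locallyCompact_secondCountable
  -- the Borel structure `mHH` IS the product structure
  have hmeq : mHH = @Prod.instMeasurableSpace ((cmDatum L 2 (Matrix.of fun i j : Fin 2 => if i.val + j.val + 1 = 2 then (1 : L) else 0)).Local v) ((cmDatum L 1 (Matrix.of fun i j : Fin 1 => if i.val + j.val + 1 = 1 then (1 : L) else 0)).Local v) _ _ :=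
    (‹BorelSpace (((cmDatum L 2 (Matrix.of fun i j : Fin 2 => if i.val + j.val + 1 = 2 then (1 : L) else 0)).Local v) × ((cmDatum L 1 (Matrix.of fun i j : Fin 1 => if i.val + j.val + 1 = 1 then (1 : L) else 0)).Local v))›.measurable_eq).trans (@BorelSpace.measurable_eq (((cmDatum L 2 (Matrix.of fun i j : Fin 2 => if i.val + j.val + 1 = 2 then (1 : L) else 0)).Local v) × ((cmDatum L 1 (Matrix.of fun i j : Fin 1 => if i.val + j.val + 1 = 1 then (1 : L) else 0)).Local v)) _ Prod.instMeasurableSpace Prod.borelSpace).symm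
  subst hmeq
  -- Haar measures: `ν₂` on `U(Φ₂)_v`, `κ₂` on `K₂ = K_{2,v}`, `μN₂` on `N₂`
  set K₂ : Subgroup ↥(unitaryGroupOfForm (conjLocal L (IsCMField.complexConj L) v) (cmLocalForm L 2 v)) := cmLocalIntegralLevel L 2 (Matrix.of fun i j : Fin 2 => if i.val + j.val + 1 = 2 then (1 : L) else 0) v with hK2
  have hKv : ∀ g : ↥(unitaryGroupOfForm (conjLocal L (IsCMField.complexConj L) v) (cmLocalForm L 2 v)), g ∈ K₂ ↔ g ∈ cmLocalIntegralLevel L 2 (Matrix.of fun i j : Fin 2 => if i.val + j.val + 1 = 2 then (1 : L) else 0) v := fun g => Iff.rfl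
  have hKco := isCompact_isOpen_cmLocalIntegralLevel L 2 (Matrix.of fun i j : Fin 2 => if i.val + j.val + 1 = 2 then (1 : L) else 0) v
  have hKo : IsOpen (K₂ : Set ↥(unitaryGroupOfForm (conjLocal L (IsCMField.complexConj L) v) (cmLocalForm L 2 v))) := hKco.2
  have hKc : IsCompact (K₂ : Set ↥(unitaryGroupOfForm (conjLocal L (IsCMField.complexConj L) v) (cmLocalForm L 2 v))) := hKco.1
  have hGK : ∀ g : ↥(unitaryGroupOfForm (conjLocal L (IsCMField.complexConj L) v) (cmLocalForm L 2 v)), ∃ b : ↥(cmBorelTriple L 2 v).P, ∃ κ ∈ K₂, g = b * κ := by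
    intro g
    obtain ⟨b, κ, hκ, hg⟩ := exists_borel_mul_mem_cmLocalIntegralLevel L 2 v g
    exact ⟨b, κ, (hKv κ).2 hκ, hg⟩
  have hKP : ∀ t ∈ (cmBorelTriple L 2 v).M, ∀ n ∈ (cmBorelTriple L 2 v).N, t * n ∈ K₂ → t ∈ K₂ := by
    intro t ht n hn htn
    exact (hKv t).2 (mem_cmLocalIntegralLevel_of_torus_mul_unipotent L 2 v ht hn ((hKv _).1 htn))
  haveI : CompactSpace ↥K₂ := isCompact_iff_compactSpace.1 hKc
  have hNcl : IsClosed ((cmBorelTriple L 2 v).N : Set ↥(unitaryGroupOfForm (conjLocal L (IsCMField.complexConj L) v) (cmLocalForm L 2 v))) :=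
    (isClosed_upperUnitriangular (n := 2) (R := LocalRing L v)).preimage continuous_subtype_val
  haveI : LocallyCompactSpace ↥(cmBorelTriple L 2 v).N := hNcl.isClosedEmbedding_subtypeVal.locallyCompactSpace
  haveI : SecondCountableTopology ↥(cmBorelTriple L 2 v).N := TopologicalSpace.Subtype.secondCountableTopology _
  haveI : SigmaCompactSpace ↥(cmBorelTriple L 2 v).N := sigmaCompactSpace_of_locallyCompact_secondCountable
  have hTcl2 := isClosed_torusU_of_t1Space (conjLocal L (IsCMField.complexConj L) v) (cmLocalForm L 2 v)
  haveI : LocallyCompactSpace ↥(cmBorelTriple L 2 v).M := hTcl2.isClosedEmbedding_subtypeVal.locallyCompactSpace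
  haveI : SecondCountableTopology ↥(cmBorelTriple L 2 v).M := TopologicalSpace.Subtype.secondCountableTopology _
  let μT : Measure ↥(cmBorelTriple L 2 v).M := Measure.haar
  let κ₂ : Measure ↥K₂ := Measure.haar
  let μN₂ : Measure ↥(cmBorelTriple L 2 v).N := Measure.haar
  let ν₂ : Measure ((cmDatum L 2 (Matrix.of fun i j : Fin 2 => if i.val + j.val + 1 = 2 then (1 : L) else 0)).Local v) := Measure.haar
  let ν₁ : Measure ((cmDatum L 1 (Matrix.of fun i j : Fin 1 => if i.val + j.val + 1 = 1 then (1 : L) else 0)).Local v) := Measure.haar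
  haveI : SigmaFinite μN₂ := inferInstance
  haveI : SigmaFinite ν₂ := inferInstance
  haveI : SigmaFinite ν₁ := inferInstance
  haveI : (ν₂.prod ν₁).IsHaarMeasure := inferInstance
  -- S2: van Dijk in torus form for `ν₂ ⊗ ν₁`, with THE calibration constant `C` of `ν₂`
  obtain ⟨C, hC, hcal, hprod⟩ := exists_smoothTrace_cmPrincipalSeriesH_eq_integral_torus L v χ₂ hχ₂ χ₁ hχ₁ K₂ hKo hKc hGK ν₂ ν₁ μT μN₂ κ₂
  -- `ν_H = s · (ν₂ ⊗ ν₁)`, `tr_{ν_H} = s · tr_{ν₂ ⊗ ν₁}`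
  have hadm := isAdmissible_cmPrincipalSeriesH L v χ₂ χ₁ hχ₁
  obtain ⟨Kl, hKl⟩ := exists_isLevel (G := (((cmDatum L 2 (Matrix.of fun i j : Fin 2 => if i.val + j.val + 1 = 2 then (1 : L) else 0)).Local v) × ((cmDatum L 1 (Matrix.of fun i j : Fin 1 => if i.val + j.val + 1 = 1 then (1 : L) else 0)).Local v))) (f := fH) ⟨hfH, hfHc⟩
  rw [Representation.smoothTrace_eq_haarScalarFactor_mul_smoothTrace (cmPrincipalSeriesH L v χ₂ χ₁) νH (ν₂.prod ν₁) hadm hfHc hKl,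
    hprod fH hfH hfHc]
  -- the innermost integrand vanishes identically
  have hzero : ∀ (t : ↥(cmBorelTriple L 2 v).M) (u : ((cmDatum L 1 (Matrix.of fun i j : Fin 1 => if i.val + j.val + 1 = 1 then (1 : L) else 0)).Local v)) (p : ↥K₂ × ↥(cmBorelTriple L 2 v).N),
      fH (((p.1 : ↥(unitaryGroupOfForm (conjLocal L (IsCMField.complexConj L) v) (cmLocalForm L 2 v))) *
            ((t : ↥(unitaryGroupOfForm (conjLocal L (IsCMField.complexConj L) v) (cmLocalForm L 2 v))) * (p.2 : ↥(unitaryGroupOfForm (conjLocal L (IsCMField.complexConj L) v) (cmLocalForm L 2 v)))) *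
            (p.1 : ↥(unitaryGroupOfForm (conjLocal L (IsCMField.complexConj L) v) (cmLocalForm L 2 v)))⁻¹ : ↥(unitaryGroupOfForm (conjLocal L (IsCMField.complexConj L) v) (cmLocalForm L 2 v))), u) = 0 := by
    intro t u p
    by_contra hne
    obtain ⟨hreg, hΩ⟩ := hsupp _ hne
    -- the point is the `(p.1, 1)`-conjugate of `(t n, u)`
    have hpt : ((((p.1 : ↥(unitaryGroupOfForm (conjLocal L (IsCMField.complexConj L) v) (cmLocalForm L 2 v))) : ((cmDatum L 2 (Matrix.of fun i j : Fin 2 => if i.val + j.val + 1 = 2 then (1 : L) else 0)).Local v)), (1 : ((cmDatum L 1 (Matrix.of fun i j : Fin 1 => if i.val + j.val + 1 = 1 then (1 : L) else 0)).Local v))) : (((cmDatum L 2 (Matrix.of fun i j : Fin 2 => if i.val + j.val + 1 = 2 then (1 : L) else 0)).Local v) × ((cmDatum L 1 (Matrix.of fun i j : Fin 1 => if i.val + j.val + 1 = 1 then (1 : L) else 0)).Local v))) * (((((t : ↥(unitaryGroupOfForm (conjLocal L (IsCMField.complexConj L) v) (cmLocalForm L 2 v))) * (p.2 : ↥(unitaryGroupOfForm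 (conjLocal L (IsCMField.complexConj L) v) (cmLocalForm L 2 v))) : ↥(unitaryGroupOfForm (conjLocal L (IsCMField.complexConj L) v) (cmLocalForm L 2 v))) : ((cmDatum L 2 (Matrix.of fun i j : Fin 2 => if i.val + j.val + 1 = 2 then (1 : L) else 0)).Local v)), u) : (((cmDatum L 2 (Matrix.of fun i j : Fin 2 => if i.val + j.val + 1 = 2 then (1 : L) else 0)).Local v) × ((cmDatum L 1 (Matrix.of fun i j : Fin 1 => if i.val + j.val + 1 = 1 then (1 : L) else 0)).Local v))) * ((((p.1 : ↥(unitaryGroupOfForm (conjLocal L (IsCMField.complexConj L) v) (cmLocalForm L 2 v))) : ((cmDatum L 2 (Matrix.of fun i j : Fin 2 => if i.val + j.val + 1 = 2 then (1 : L) else 0)).Local v)), (1 : ((cmDatum L 1 (Matrix.of fun i j : Fin 1 => if i.val + j.val + 1 = 1 then (1 : L) else 0)).Local v))) : (((cmDatum L 2 (Matrix.of fun i j : Fin 2 => if i.val + j.val + 1 = 2 then (1 : L) else 0)).Local v) × ((cmDatum L 1 (Matrix.of fun i j : Fin 1 => if i.val + j.val + 1 = 1 then (1 : L) else 0)).Local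 v)))⁻¹ =
        ((((p.1 : ↥(unitaryGroupOfForm (conjLocal L (IsCMField.complexConj L) v) (cmLocalForm L 2 v))) * ((t : ↥(unitaryGroupOfForm (conjLocal L (IsCMField.complexConj L) v) (cmLocalForm L 2 v))) * (p.2 : ↥(unitaryGroupOfForm (conjLocal L (IsCMField.complexConj L) v) (cmLocalForm L 2 v)))) * (p.1 : ↥(unitaryGroupOfForm (conjLocal L (IsCMField.complexConj L) v) (cmLocalForm L 2 v)))⁻¹ : ↥(unitaryGroupOfForm (conjLocal L (IsCMField.complexConj L) v) (cmLocalForm L 2 v))) : ((cmDatum L 2 (Matrix.of fun i j : Fin 2 => if i.val + j.val + 1 = 2 then (1 : L) else 0)).Local v)), u) :=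
      Prod.ext rfl (by simp only [Prod.snd_mul, Prod.snd_inv, inv_one, one_mul, mul_one])
    have hreg2 : IsLocalGRegular L v (((((p.1 : ↥(unitaryGroupOfForm (conjLocal L (IsCMField.complexConj L) v) (cmLocalForm L 2 v))) : ((cmDatum L 2 (Matrix.of fun i j : Fin 2 => if i.val + j.val + 1 = 2 then (1 : L) else 0)).Local v)), (1 : ((cmDatum L 1 (Matrix.of fun i j : Fin 1 => if i.val + j.val + 1 = 1 then (1 : L) else 0)).Local v))) : (((cmDatum L 2 (Matrix.of fun i j : Fin 2 => if i.val + j.val + 1 = 2 then (1 : L) else 0)).Local v) × ((cmDatum L 1 (Matrix.of fun i j : Fin 1 => if i.val + j.val + 1 = 1 then (1 : L) else 0)).Local v))) * (((((t : ↥(unitaryGroupOfForm (conjLocal L (IsCMField.complexConj L) v) (cmLocalForm L 2 v))) * (p.2 : ↥(unitaryGroupOfForm (conjLocal L (IsCMField.complexConj L) v) (cmLocalForm L 2 v))) : ↥(unitaryGroupOfForm (conjLocal L (IsCMField.complexConj L) v) (cmLocalForm L 2 v))) : ((cmDatum L 2 (Matrix.of fun i j : Fin 2 => if i.val + j.val +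 1 = 2 then (1 : L) else 0)).Local v)), u) : (((cmDatum L 2 (Matrix.of fun i j : Fin 2 => if i.val + j.val + 1 = 2 then (1 : L) else 0)).Local v) × ((cmDatum L 1 (Matrix.of fun i j : Fin 1 => if i.val + j.val + 1 = 1 then (1 : L) else 0)).Local v))) * ((((p.1 : ↥(unitaryGroupOfForm (conjLocal L (IsCMField.complexConj L) v) (cmLocalForm L 2 v))) : ((cmDatum L 2 (Matrix.of fun i j : Fin 2 => if i.val + j.val + 1 = 2 then (1 : L) else 0)).Local v)), (1 : ((cmDatum L 1 (Matrix.of fun i j : Fin 1 => if i.val + j.val + 1 = 1 then (1 : L) else 0)).Local v))) : (((cmDatum L 2 (Matrix.of fun i j : Fin 2 => if i.val + j.val + 1 = 2 then (1 : L) else 0)).Local v) × ((cmDatum L 1 (Matrix.of fun i j : Fin 1 => if i.val + j.val + 1 = 1 then (1 : L) else 0)).Local v)))⁻¹) := by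
      rw [hpt]; exact hreg
    have hreg' : IsLocalGRegular L v (((((t : ↥(unitaryGroupOfForm (conjLocal L (IsCMField.complexConj L) v) (cmLocalForm L 2 v))) * (p.2 : ↥(unitaryGroupOfForm (conjLocal L (IsCMField.complexConj L) v) (cmLocalForm L 2 v))) : ↥(unitaryGroupOfForm (conjLocal L (IsCMField.complexConj L) v) (cmLocalForm L 2 v))) : ((cmDatum L 2 (Matrix.of fun i j : Fin 2 => if i.val + j.val + 1 = 2 then (1 : L) else 0)).Local v)), u) : (((cmDatum L 2 (Matrix.of fun i j : Fin 2 => if i.val + j.val + 1 = 2 then (1 : L) else 0)).Local v) × ((cmDatum L 1 (Matrix.of fun i j : Fin 1 => if i.val + j.val + 1 = 1 then (1 : L) else 0)).Local v))) := (isLocalGRegular_conj_iff L ((((p.1 : ↥(unitaryGroupOfForm (conjLocal L (IsCMField.complexConj L) v) (cmLocalForm L 2 v))) : ((cmDatum L 2 (Matrix.of fun i j : Fin 2 => if i.val + j.val + 1 = 2 then (1 : L) else 0)).Local v)), (1 : ((cmDatum L 1 (Matrix.of fun i j : Fin 1 => if i.val + j.val + 1 = 1 then (1 : L) else 0)).Local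 v))) : (((cmDatum L 2 (Matrix.of fun i j : Fin 2 => if i.val + j.val + 1 = 2 then (1 : L) else 0)).Local v) × ((cmDatum L 1 (Matrix.of fun i j : Fin 1 => if i.val + j.val + 1 = 1 then (1 : L) else 0)).Local v))) (((((t : ↥(unitaryGroupOfForm (conjLocal L (IsCMField.complexConj L) v) (cmLocalForm L 2 v))) * (p.2 : ↥(unitaryGroupOfForm (conjLocal L (IsCMField.complexConj L) v) (cmLocalForm L 2 v))) : ↥(unitaryGroupOfForm (conjLocal L (IsCMField.complexConj L) v) (cmLocalForm L 2 v))) : ((cmDatum L 2 (Matrix.of fun i j : Fin 2 => if i.val + j.val + 1 = 2 then (1 : L) else 0)).Local v)), u) : (((cmDatum L 2 (Matrix.of fun i j : Fin 2 => if i.val + j.val + 1 = 2 then (1 : L) else 0)).Local v) × ((cmDatum L 1 (Matrix.of fun i j : Fin 1 => if i.val + j.val + 1 = 1 then (1 : L) else 0)).Local v)))).1 hreg2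
    have hmem := endoEmbLocal_torus_mul_unipotent_mem_hyperbolicSet L v hns t p.2 u hreg'
    have hmem2 := conj_mem_hyperbolicSet L v hmem (endoEmbLocal L v ((((p.1 : ↥(unitaryGroupOfForm (conjLocal L (IsCMField.complexConj L) v) (cmLocalForm L 2 v))) : ((cmDatum L 2 (Matrix.of fun i j : Fin 2 => if i.val + j.val + 1 = 2 then (1 : L) else 0)).Local v)), (1 : ((cmDatum L 1 (Matrix.of fun i j : Fin 1 => if i.val + j.val + 1 = 1 then (1 : L) else 0)).Local v))) : (((cmDatum L 2 (Matrix.of fun i j : Fin 2 => if i.val + j.val + 1 = 2 then (1 : L) else 0)).Local v) × ((cmDatum L 1 (Matrix.of fun i j : Fin 1 => if i.val + j.val + 1 = 1 then (1 : L) else 0)).Local v))))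
    rw [← map_mul, ← map_inv, ← map_mul] at hmem2
    rw [hpt] at hmem2
    exact hΩ hmem2
  simp only [hzero, integral_zero, mul_zero]

/-! ## §3 `V_H` is open -/

set_option maxHeartbeats 1600000 in
set_option synthInstance.maxHeartbeats 400000 in
/-- **`V_H = {a ∈ H_v | a G-regular ∧ ι a ∉ Ω}` is OPEN** (non-split `v`): it is the preimage of the open set `G^r ∖ Ω` (★ S8a
`isOpen_setOf_isRegularElt_and_not_mem_hyperbolicSet`) under the continuous endoscopic embedding `ι = endoEmbLocal L v` (★ `continuous_endoEmbLocal`);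
`G`-regularity of `a` is by definition regularity of `ι a`. [cite: Rogawski1990, §12.5 pp. 182–184; §4.3 p. 42] -/
theorem isOpen_setOf_isLocalGRegular_and_not_mem_hyperbolicSet (hns : ∀ w : PlacesOver L v, IsCMField.complexConj L • w.1 = w.1) :
    IsOpen {a : (((cmDatum L 2 (Matrix.of fun i j : Fin 2 => if i.val + j.val + 1 = 2 then (1 : L) else 0)).Local v) × ((cmDatum L 1 (Matrix.of fun i j : Fin 1 => if i.val + j.val + 1 = 1 then (1 : L) else 0)).Local v)) | IsLocalGRegular L v a ∧ endoEmbLocal L v a ∉ hyperbolicSet L v} :=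
  (F0P3cStCharTSEllOpen.isOpen_setOf_isRegularElt_and_not_mem_hyperbolicSet L v hns).preimage (continuous_endoEmbLocal L v)

/-! ## §4 «ELL-VALUE-H»: `Θ = −ξ_v` on `V_H` -/

set_option maxHeartbeats 1600000 in
set_option synthInstance.maxHeartbeats 400000 in
/-- **«ELL-VALUE-H★»: the character of the `H`-side Steinberg label equals `−ξ_v` at every `G`-regular point of `H_v` whose image lies off `Ω`.**
For the organ's labels `(π₁, πSt)` (`HLengthTwoLabels` of `i_H(χ_H)`, `Tr π₁ = χ_{ξ_v}`), any Haar `νHv` (left+right invariant) and any `Θ : H_v → ℂ` locally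
constant at the `G`-regular points with `Tr πSt(f_H) = ∫ f_H Θ dνHv` on test functions: `Θ a = −ξ_v(a)` for all `a ∈ V_H`.  (Module docstring: localise on a compact-open
`U ∋ a` inside `V_H` where `Θ` and `ξ_v` are constant; ★ HSt + §2 «VAN-DIJK-VANISH-H» + `νHv(U) > 0`.)
[cite: Rogawski1990, §12.1 pp. 171–172; §4.9 (4.9.4) p. 56; §12.5 pp. 182–183] [cite: vanDijk1972, Thm. p. 237] -/
theorem charSt_eq_neg_xiLocalChar_of_not_mem_hyperbolicSet (hns : ∀ w : PlacesOver L v, IsCMField.complexConj L • w.1 = w.1)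
    [mHH : MeasurableSpace (((cmDatum L 2 (Matrix.of fun i j : Fin 2 => if i.val + j.val + 1 = 2 then (1 : L) else 0)).Local v) × ((cmDatum L 1 (Matrix.of fun i j : Fin 1 => if i.val + j.val + 1 = 1 then (1 : L) else 0)).Local v))] [BorelSpace (((cmDatum L 2 (Matrix.of fun i j : Fin 2 => if i.val + j.val + 1 = 2 then (1 : L) else 0)).Local v) × ((cmDatum L 1 (Matrix.of fun i j : Fin 1 => if i.val + j.val + 1 = 1 then (1 : L) else 0)).Local v))]
    (νHv : Measure (((cmDatum L 2 (Matrix.of fun i j : Fin 2 => if i.val + j.val + 1 = 2 then (1 : L) else 0)).Local v) × ((cmDatum L 1 (Matrix.of fun i j : Fin 1 => if i.val + j.val + 1 = 1 then (1 : L) else 0)).Local v))) [νHv.IsHaarMeasure] [νHv.IsMulRightInvariant]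
    (ξ : OneDimAutRepH L)
    (π₁ πSt : IrrClass (((cmDatum L 2 (Matrix.of fun i j : Fin 2 => if i.val + j.val + 1 = 2 then (1 : L) else 0)).Local v) × ((cmDatum L 1 (Matrix.of fun i j : Fin 1 => if i.val + j.val + 1 = 1 then (1 : L) else 0)).Local v)))
    (hlab : HLengthTwoLabels L v
      (torusCharPair (conjLocal L (IsCMField.complexConj L) v) (cmLocalForm L 2 v) (cmLocalForm_eq_over L 2 v) 0
        ((torusLocalComponent L (IsCMField.complexConj L) v ξ.η).comp
            (quotConj (conjLocal L (IsCMField.complexConj L) v) (conjLocal_conjLocal_cm L v)) *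
          halfModulusChar (UnitaryGroup.LocalRing L v))
        (torusLocalComponent L (IsCMField.complexConj L) v ξ.ψ))
      ((torusLocalComponent L (IsCMField.complexConj L) v ξ.ψ).comp (localDet (IsCMField.complexConj L) v (isUnit_antidiagOne_det L 1))) π₁ πSt)
    (hπ₁ : ∀ fH : (((cmDatum L 2 (Matrix.of fun i j : Fin 2 => if i.val + j.val + 1 = 2 then (1 : L) else 0)).Local v) × ((cmDatum L 1 (Matrix.of fun i j : Fin 1 => if i.val + j.val + 1 = 1 then (1 : L) else 0)).Local v)) → ℂ, IsLocSmooth fH → π₁.smoothTrace νHv fH = charDist (ξ.xiLocalChar v) νHv fH)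
    (Θ : (((cmDatum L 2 (Matrix.of fun i j : Fin 2 => if i.val + j.val + 1 = 2 then (1 : L) else 0)).Local v) × ((cmDatum L 1 (Matrix.of fun i j : Fin 1 => if i.val + j.val + 1 = 1 then (1 : L) else 0)).Local v)) → ℂ)
    (hlc : ∀ x : (((cmDatum L 2 (Matrix.of fun i j : Fin 2 => if i.val + j.val + 1 = 2 then (1 : L) else 0)).Local v) × ((cmDatum L 1 (Matrix.of fun i j : Fin 1 => if i.val + j.val + 1 = 1 then (1 : L) else 0)).Local v)), IsLocalGRegular L v x → ∀ᶠ y in 𝓝 x, Θ y = Θ x)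
    (htr : ∀ fH : (((cmDatum L 2 (Matrix.of fun i j : Fin 2 => if i.val + j.val + 1 = 2 then (1 : L) else 0)).Local v) × ((cmDatum L 1 (Matrix.of fun i j : Fin 1 => if i.val + j.val + 1 = 1 then (1 : L) else 0)).Local v)) → ℂ, IsLocSmooth fH → πSt.smoothTrace νHv fH = ∫ h, fH h * Θ h ∂νHv)
    {a : (((cmDatum L 2 (Matrix.of fun i j : Fin 2 => if i.val + j.val + 1 = 2 then (1 : L) else 0)).Local v) × ((cmDatum L 1 (Matrix.of fun i j : Fin 1 => if i.val + j.val + 1 = 1 then (1 : L) else 0)).Local v))} (ha : IsLocalGRegular L v a) (haΩ : endoEmbLocal L v a ∉ hyperbolicSet L v) :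
    Θ a = -(((ξ.xiLocalChar v) a : ℂˣ) : ℂ) := by
  haveI : TotallyDisconnectedSpace ((cmDatum L 2 (Matrix.of fun i j : Fin 2 => if i.val + j.val + 1 = 2 then (1 : L) else 0)).Local v) :=
    totallyDisconnectedSpace_cmDatum_local L 2 (Matrix.of fun i j : Fin 2 => if i.val + j.val + 1 = 2 then (1 : L) else 0) v
  haveI : TotallyDisconnectedSpace ((cmDatum L 1 (Matrix.of fun i j : Fin 1 => if i.val + j.val + 1 = 1 then (1 : L) else 0)).Local v) :=
    totallyDisconnectedSpace_cmDatum_local L 1 (Matrix.of fun i j : Fin 1 => if i.val + j.val + 1 = 1 then (1 : L) else 0) v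
  haveI : LocallyCompactSpace ((cmDatum L 2 (Matrix.of fun i j : Fin 2 => if i.val + j.val + 1 = 2 then (1 : L) else 0)).Local v) := locallyCompactSpace_local (IsCMField.complexConj L) 2 _ v
  haveI : LocallyCompactSpace ((cmDatum L 1 (Matrix.of fun i j : Fin 1 => if i.val + j.val + 1 = 1 then (1 : L) else 0)).Local v) := locallyCompactSpace_local (IsCMField.complexConj L) 1 _ v
  haveI : T2Space ((cmDatum L 2 (Matrix.of fun i j : Fin 2 => if i.val + j.val + 1 = 2 then (1 : L) else 0)).Local v) := t2Space_cmDatum_local 2 L (Matrix.of fun i j : Fin 2 => if i.val + j.val + 1 = 2 then (1 : L) else 0) v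
  haveI : T2Space ((cmDatum L 1 (Matrix.of fun i j : Fin 1 => if i.val + j.val + 1 = 1 then (1 : L) else 0)).Local v) := t2Space_cmDatum_local 1 L (Matrix.of fun i j : Fin 1 => if i.val + j.val + 1 = 1 then (1 : L) else 0) v
  haveI := nonarchimedeanGroup_cmLocal L 2 v
  haveI := nonarchimedeanGroup_cmLocal L 1 v
  haveI : NonarchimedeanGroup ((cmDatum L 2 (Matrix.of fun i j : Fin 2 => if i.val + j.val + 1 = 2 then (1 : L) else 0)).Local v) := ‹NonarchimedeanGroup ↥(unitaryGroupOfForm (conjLocal L (IsCMField.complexConj L) v) (cmLocalForm L 2 v))›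
  haveI : NonarchimedeanGroup ((cmDatum L 1 (Matrix.of fun i j : Fin 1 => if i.val + j.val + 1 = 1 then (1 : L) else 0)).Local v) := ‹NonarchimedeanGroup ↥(unitaryGroupOfForm (conjLocal L (IsCMField.complexConj L) v) (cmLocalForm L 1 v))›
  -- `ξ_v` is locally constant (open kernel)
  have hξo := F0P3XiLocalCharOpenKernel.isOpen_ker_xiLocalChar L ξ v
  have hξa : {y : (((cmDatum L 2 (Matrix.of fun i j : Fin 2 => if i.val + j.val + 1 = 2 then (1 : L) else 0)).Local v) × ((cmDatum L 1 (Matrix.of fun i j : Fin 1 => if i.val + j.val + 1 = 1 then (1 : L) else 0)).Local v)) | (ξ.xiLocalChar v) y = (ξ.xiLocalChar v) a} ∈ 𝓝 a := by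
    have hpre : {y : (((cmDatum L 2 (Matrix.of fun i j : Fin 2 => if i.val + j.val + 1 = 2 then (1 : L) else 0)).Local v) × ((cmDatum L 1 (Matrix.of fun i j : Fin 1 => if i.val + j.val + 1 = 1 then (1 : L) else 0)).Local v)) | (ξ.xiLocalChar v) y = (ξ.xiLocalChar v) a} = (fun y => y * a⁻¹) ⁻¹' ((ξ.xiLocalChar v).ker : Set (((cmDatum L 2 (Matrix.of fun i j : Fin 2 => if i.val + j.val + 1 = 2 then (1 : L) else 0)).Local v) × ((cmDatum L 1 (Matrix.of fun i j : Fin 1 => if i.val + j.val + 1 = 1 then (1 : L) else 0)).Local v))) := by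
      ext y
      simp only [Set.mem_setOf_eq, Set.mem_preimage, SetLike.mem_coe, MonoidHom.mem_ker, map_mul, map_inv, mul_inv_eq_one]
    have hopen : IsOpen {y : (((cmDatum L 2 (Matrix.of fun i j : Fin 2 => if i.val + j.val + 1 = 2 then (1 : L) else 0)).Local v) × ((cmDatum L 1 (Matrix.of fun i j : Fin 1 => if i.val + j.val + 1 = 1 then (1 : L) else 0)).Local v)) | (ξ.xiLocalChar v) y = (ξ.xiLocalChar v) a} := by
      rw [hpre]; exact hξo.preimage (continuous_id.mul continuous_const)
    exact hopen.mem_nhds rfl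
  -- a compact-open `U ∋ a` inside `V_H` on which `Θ` and `ξ_v` are constant
  have hW : ({y : (((cmDatum L 2 (Matrix.of fun i j : Fin 2 => if i.val + j.val + 1 = 2 then (1 : L) else 0)).Local v) × ((cmDatum L 1 (Matrix.of fun i j : Fin 1 => if i.val + j.val + 1 = 1 then (1 : L) else 0)).Local v)) | IsLocalGRegular L v y ∧ endoEmbLocal L v y ∉ hyperbolicSet L v} ∩
      ({y | Θ y = Θ a} ∩ {y : (((cmDatum L 2 (Matrix.of fun i j : Fin 2 => if i.val + j.val + 1 = 2 then (1 : L) else 0)).Local v) × ((cmDatum L 1 (Matrix.of fun i j : Fin 1 => if i.val + j.val + 1 = 1 then (1 : L) else 0)).Local v)) | (ξ.xiLocalChar v) y = (ξ.xiLocalChar v) a})) ∈ 𝓝 a :=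
    inter_mem ((isOpen_setOf_isLocalGRegular_and_not_mem_hyperbolicSet L v hns).mem_nhds ⟨ha, haΩ⟩) (inter_mem (hlc a ha) hξa)
  obtain ⟨O, hOW, hOo, haO⟩ := mem_nhds_iff.1 hW
  obtain ⟨U, hUc, hUo, haU, hUO⟩ := Literature.Topology.exists_isCompact_isOpen_mem_subset hOo haO
  have hUW : U ⊆ _ := hUO.trans hOW
  have hφ : IsLocSmooth (U.indicator fun _ => (1 : ℂ)) := isLocSmooth_indicator hUo hUc.isClosed hUc
  -- `Tr πSt(𝟙_U) = ν(U)·Θ a`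
  have hT : πSt.smoothTrace νHv (U.indicator fun _ => (1 : ℂ)) = (νHv.real U : ℂ) * Θ a := by
    rw [htr _ hφ]
    exact F0P3cStCharTSCasselmanCap.integral_indicator_mul_eq_of_eqOn νHv hUo.measurableSet _ a fun g hg => (hUW hg).2.1
  -- `χ_{ξ_v}(𝟙_U) = ν(U)·ξ_v(a)`
  have hX : charDist (ξ.xiLocalChar v) νHv (U.indicator fun _ => (1 : ℂ)) = (νHv.real U : ℂ) * (((ξ.xiLocalChar v) a : ℂˣ) : ℂ) := by
    rw [charDist_def]
    have hcomm : (fun h : (((cmDatum L 2 (Matrix.of fun i j : Fin 2 => if i.val + j.val + 1 = 2 then (1 : L) else 0)).Local v) × ((cmDatum L 1 (Matrix.of fun i j : Fin 1 => if i.val + j.val + 1 = 1 then (1 : L) else 0)).Local v)) => (((ξ.xiLocalChar v) h : ℂˣ) : ℂ) * U.indicator (fun _ => (1 : ℂ)) h) =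
        fun h => U.indicator (fun _ => (1 : ℂ)) h * (((ξ.xiLocalChar v) h : ℂˣ) : ℂ) := funext fun h => mul_comm _ _
    rw [hcomm]
    exact F0P3cStCharTSCasselmanCap.integral_indicator_mul_eq_of_eqOn νHv hUo.measurableSet (fun h => (((ξ.xiLocalChar v) h : ℂˣ) : ℂ)) a
      fun g hg => by rw [(hUW hg).2.2]
  -- `Tr i_H(χ_H)(𝟙_U) = 0` (§2): the continuity ∕ open-kernel inputs of ★ S2 for the organ's characters
  have hηc := continuous_torusLocalComponent L (IsCMField.complexConj L) (v := v) ξ.η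
  have hψc := continuous_torusLocalComponent L (IsCMField.complexConj L) (v := v) ξ.ψ
  have h1c : Continuous fun x : ((UnitaryGroup.LocalRing L v))ˣ =>
      (((((torusLocalComponent L (IsCMField.complexConj L) v ξ.η).comp (quotConj (conjLocal L (IsCMField.complexConj L) v) (conjLocal_conjLocal_cm L v))) *
        halfModulusChar (UnitaryGroup.LocalRing L v)) x : ℂˣ) : ℂ) := by
    have hq := continuous_quotConj (conjLocal L (IsCMField.complexConj L) v) (conjLocal_conjLocal_cm L v) (continuous_conjLocal L (IsCMField.complexConj L) v)
    simp only [MonoidHom.mul_apply, MonoidHom.comp_apply, Units.val_mul]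
    exact (hηc.comp hq).mul (continuous_halfModulusChar_apply L v)
  have hχ₂ : Continuous fun t => ((((torusCharPair (conjLocal L (IsCMField.complexConj L) v) (cmLocalForm L 2 v) (cmLocalForm_eq_over L 2 v) 0
        ((torusLocalComponent L (IsCMField.complexConj L) v ξ.η).comp
            (quotConj (conjLocal L (IsCMField.complexConj L) v) (conjLocal_conjLocal_cm L v)) *
          halfModulusChar (UnitaryGroup.LocalRing L v))
        (torusLocalComponent L (IsCMField.complexConj L) v ξ.ψ))) t : ℂˣ) : ℂ) :=
    continuous_torusCharPair_apply (conjLocal L (IsCMField.complexConj L) v) (cmLocalForm L 2 v) (cmLocalForm_eq_over L 2 v) 0 _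
      (torusLocalComponent L (IsCMField.complexConj L) v ξ.ψ) h1c hψc
  have hχ₁ := F0P3bHPrincipalSeriesJHOfUTwo.isOpen_ker_of_continuous_unitsComplex (G := ((cmDatum L 1 (Matrix.of fun i j : Fin 1 => if i.val + j.val + 1 = 1 then (1 : L) else 0)).Local v)) ((torusLocalComponent L (IsCMField.complexConj L) v ξ.ψ).comp (localDet (IsCMField.complexConj L) v (isUnit_antidiagOne_det L 1)))
    (hψc.comp (continuous_localDet (IsCMField.complexConj L) v (isUnit_antidiagOne_det L 1) (J := (Matrix.of fun i j : Fin 1 => if i.val + j.val + 1 = 1 then (1 : L) else 0))))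
  have h0 := smoothTrace_cmPrincipalSeriesH_eq_zero_of_support L v hns νHv ((torusCharPair (conjLocal L (IsCMField.complexConj L) v) (cmLocalForm L 2 v) (cmLocalForm_eq_over L 2 v) 0
        ((torusLocalComponent L (IsCMField.complexConj L) v ξ.η).comp
            (quotConj (conjLocal L (IsCMField.complexConj L) v) (conjLocal_conjLocal_cm L v)) *
          halfModulusChar (UnitaryGroup.LocalRing L v))
        (torusLocalComponent L (IsCMField.complexConj L) v ξ.ψ))) hχ₂ ((torusLocalComponent L (IsCMField.complexConj L) v ξ.ψ).comp (localDet (IsCMField.complexConj L) v (isUnit_antidiagOne_det L 1))) hχ₁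
      (U.indicator fun _ => (1 : ℂ)) hφ.1 hφ.2 (fun h hh => (hUW (Set.mem_of_indicator_ne_zero hh)).1)
  -- ★ HSt: `Tr πSt = Tr i_H − χ_{ξ_v}`
  have hSt := F0P3cStCharTSHSt.steinbergLabel_smoothTrace_eq L v νHv ξ hns π₁ πSt hlab hπ₁ _ hφ
  rw [hT, h0, hX, zero_sub] at hSt
  -- `ν(U) > 0`
  have hpos : (νHv.real U : ℂ) ≠ 0 := by
    have hp : 0 < νHv.real U :=
      ENNReal.toReal_pos (hUo.measure_pos νHv ⟨a, haU⟩).ne' hUc.measure_lt_top.ne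
    exact_mod_cast hp.ne'
  exact mul_left_cancel₀ hpos (hSt.trans (neg_mul_eq_mul_neg _ _))

end Summit.HodgeConjecture.HodgeConjecture.Cruxes.H413.F0P3cStCharTSStStableEll

end
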